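import Summits.BirchSwinnertonDyer.Rank1Residual.X11b.RingClassFieldConj
import Summits.BirchSwinnertonDyer.Rank1Residual.X11b.KolyvaginH37Bridge
import Summits.BirchSwinnertonDyer.Rank1Residual.X11b.KolyvaginPointClassFixed
import HarnessLib

/-!
# Carrier port K3 for crux 19718 (`ShimuraKolyvaginOrderBoundInertFromFive`): complex conjugation
# along a BARE embedding `K[m] → K̄`, and the bottom level `P_1 = Tr_{K[1]/K} y_1 = y_K`

Cell `bsd-stepL`, seat `shim-p1` (g8), item `stmt-BirchSwinnertonDyer-19718`, route
`ErratumRoadFive` (K2). Summit-side THEOREM-ONLY helper file (no definition, no named fact, no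
`sorry`), `--supports stmt-BirchSwinnertonDyer-19718 --as helper`; `K : Type`; nothing `p`-specific.

HONEST FRAMING. This is brick K3 of the CARRIER PORT (memo `HOME/shim/CARRIER-PORT-19718.md` §2):
the three pieces of GEOMETRIC GLUE that the abstract eigen-clause ∕ `τ̃`-stability theorems of
p476190 (`exists_pointsMap_map_kolyvaginPoint_eq_of_prop53`, `pointsMap_mem_range_of_glue`) and the
bottom clause `Pt 1 = toGeomPoints (W⁄K) y_K` of the `hpointsRk` binder of p482014
(`sha_primary_eq_zero_of_ringClassRationalPointsM_shift`) take as hypotheses, proved for a BARE ring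
embedding `emb : K[m] →+* K̄` that is the identity on `K` — the currency of the anchor-free level data
of p487239 (`exists_ringClassLevelData`) — instead of x11b3's `KolyvaginHeegnerData` container (which
is EMPTY on the Shimura locus: its fields `dvd_sq_sub` ∕ `map_y` are the modular-curve Heegner
hypothesis). Every proof is the proof of the corresponding x11b3 lemma with `d.emb ↦ emb`,
`d.toGeomPoints ↦ j` (`RingClassConj.exists_algEquiv_apply_emb_eq`, `pointsMap_toGeomPoints_eq`,
`exists_mem_ringClassGal_apply_emb_eq`; `KolyvaginBottom.toGeomPoints_map_algebraMap`; the level-`1`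
computation `P(1) = Σ_{s ∈ 𝒢_1} s y(1)` of `HeegnerPointsOfConductorOneData`). The printed input at the
bottom is the LABEL (B2) `y_K ↑ K[1] = Σ_{g ∈ 𝒢_1} g y(1)` (Gross 1991 (4.1) `P_1 = Tr_{K_1/K} y_1 = y_K`;
Bertolini–Darmon 1996 §2.5 for `X_{N⁺,N⁻}`), taken as a hypothesis `hB2`, NOT discharged. Nothing is
discharged on the crux; S1 ∕ S2 untouched; nothing booked.

## What is proved (namespace `Summit.BirchSwinnertonDyer.BirchSwinnertonDyer.Theorems`)

* `exists_algEquiv_apply_ringHom_eq` — a ring automorphism `φ` of `K̄` restricts along `emb` to some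
  `g ∈ Aut_ℚ(K[n])`: `φ (emb x) = emb (g x)` (`K[n]/ℚ` Galois).
* `pointsMap_map_ringHom_eq` — coordinatewise transport: if a lift `τ̃` of `c ∈ Aut(K/ℚ)` restricts
  along `emb` to `g`, then `τ̃ · (j P) = j (g • P)` for `j = E(emb) : E(K[n]) → E(K̄)`.
* `exists_mem_ringClassGal_apply_ringHom_eq` — for `c ≠ 1` the restriction is `τ_n · h` with
  `h ∈ 𝒢_n` (`τ_n` any conjugation automorphism of `K[n]`), provided `emb` is the identity on `K`.
* `map_map_algebraMap_eq_toGeomPoints` — `j (P₀ ↑ K[n]) = toGeomPoints (W⁄K) P₀` for `P₀ ∈ E(K)`.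
* `mem_transversal_one_iff` — at conductor `1` a transversal of `G_1 = Gal(K[1]/K[1]) = 1` in `𝒢_1`
  is all of `𝒢_1`.
* `map_kolyvaginPoint_one_eq_toGeomPoints` — THE BOTTOM CLAUSE: with the bridge dictionary of
  p488224 (`ρ`, `iA`, transversal `S`, section `f`) at level `1` and the label (B2),
  `j (iA (P(1))) = toGeomPoints (W⁄K) y_K`.

References: [cite: GrossLMS1991, §3 (p. 238), §4 (4.1), §5] [cite: BertoliniDarmon1996, §2.5, Prop. 2.6]
[cite: Cox2013, §9.A Lemma 9.3] [cite: McCallumLMS1991, §4 (4)–(5)]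
-/

noncomputable section

open scoped Classical

set_option linter.dupNamespace false

namespace Summit.BirchSwinnertonDyer.BirchSwinnertonDyer.Theorems

open WeierstrassCurve Field NumberField Finset
  Literature.NumberTheory.EllipticCurves
  Literature.NumberTheory.EllipticCurves.KolyvaginEuler
  Literature.NumberTheory.EllipticCurves.RingClassField
  Summit.BirchSwinnertonDyer.Rank1Residual.X11b

variable {K : Type} [Field K] [NumberField K] {W : WeierstrassCurve ℚ} {ι : K →+* ℂ} {n : ℕ}

/-! ### §1 Complex conjugation along a bare embedding `K[n] → K̄` -/

/-- **A ring automorphism of `K̄` restricts along `emb` to an automorphism of `K[n]`** (`n ≠ 0`):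
`φ (emb x) = emb (g x)` for some `g ∈ Aut_ℚ(K[n])`, because `K[n]/ℚ` is Galois
(`RingClassConj.exists_algEquiv_forall_apply_eq` applied to `emb` and `φ ∘ emb`). Twin of x11b3's
`RingClassConj.exists_algEquiv_apply_emb_eq` for a bare embedding.
[cite: GrossLMS1991, §5 (τ acts on the Galois extension K_n)] [cite: Cox2013, §9.A Lemma 9.3] -/
theorem exists_algEquiv_apply_ringHom_eq (hK : IsImaginaryQuadratic K) (ι : K →+* ℂ) (hn : n ≠ 0)
    (emb : ringClassField K ι n →+* AlgebraicClosure K)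
    (φ : AlgebraicClosure K ≃+* AlgebraicClosure K) :
    ∃ g : ringClassField K ι n ≃ₐ[ℚ] ringClassField K ι n, ∀ x, φ (emb x) = emb (g x) :=
  RingClassConj.exists_algEquiv_forall_apply_eq hK ι hn emb (φ.toRingHom.comp emb)

/-- **Coordinatewise transport along a bare embedding**: if a lift `τ̃` of `c ∈ Aut(K/ℚ)` restricts
along `emb` to `g ∈ Aut_ℚ(K[n])` (`τ̃ (emb x) = emb (g x)`), then `τ̃ · (j P) = j (g • P)` for every
`P ∈ E(K[n])`, where `j = E(emb)` (both actions are `Affine.Point.map`). Twin of x11b3's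
`RingClassConj.pointsMap_toGeomPoints_eq`. [folklore] -/
theorem pointsMap_map_ringHom_eq (emb : ringClassField K ι n →+* AlgebraicClosure K)
    (j : (W.baseChange (ringClassField K ι n)).toAffine.Point →+ geomPoints (W.baseChange K))
    (hj : j = WeierstrassCurve.Affine.Point.map (W' := W) emb.toRatAlgHom)
    {c : K ≃ₐ[ℚ] K} {τ : AlgebraicClosure K ≃+* AlgebraicClosure K} (hτ : IsLiftOfAut c τ)
    {g : ringClassField K ι n ≃ₐ[ℚ] ringClassField K ι n} (h : ∀ x, τ (emb x) = emb (g x))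
    (P : (W.baseChange (ringClassField K ι n)).toAffine.Point) :
    hτ.pointsMap W (j P) = j (pointGalHom W (ringClassField K ι n) g P) := by
  have hjQ : ∀ Q, j Q = WeierstrassCurve.Affine.Point.map (W' := W) emb.toRatAlgHom Q :=
    fun Q ↦ DFunLike.congr_fun hj Q
  rcases P with _ | ⟨x, y, hxy⟩
  · change hτ.pointsMap W (j 0) = j (pointGalHom W (ringClassField K ι n) g 0)
    rw [map_zero, map_zero, map_zero, map_zero]
  · -- both sides are the affine point with coordinates `τ (emb x) = emb (g x)`, `τ (emb y) = emb (g y)`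
    rw [hjQ, hjQ]
    exact Affine.Point.some_eq_some_of_eq (h x) (h y)

/-- **For a NON-TRIVIAL `c` the restriction lies in the coset `τ_n 𝒢_n`**: a lift `τ̃` of `c ≠ 1`
restricts along an embedding `emb : K[n] → K̄` that is the identity on `K` to `g = τ_n h` with
`h ∈ 𝒢_n = Gal(K[n]/K)` (`τ_n` any conjugation automorphism of `K[n]`, hypothesis `hτn`) — as
`g ∈ 𝒢_n` would force `τ̃` to fix `K`. Twin of x11b3's `RingClassConj.exists_mem_ringClassGal_apply_emb_eq`.
[cite: GrossLMS1991, §3 (p. 238), §5] -/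
theorem exists_mem_ringClassGal_apply_ringHom_eq (hK : IsImaginaryQuadratic K) (ι : K →+* ℂ)
    (hn : n ≠ 0) (emb : ringClassField K ι n →+* AlgebraicClosure K)
    (hemb : ∀ k : K, emb (algebraMap K (ringClassField K ι n) k) = algebraMap K (AlgebraicClosure K) k)
    {c : K ≃ₐ[ℚ] K} (hc : c ≠ 1)
    {τ : AlgebraicClosure K ≃+* AlgebraicClosure K} (hτ : IsLiftOfAut c τ)
    {τn : ringClassField K ι n ≃ₐ[ℚ] ringClassField K ι n}
    (hτn : ∀ x : ringClassField K ι n, ((τn x : ringClassField K ι n) : ℂ) = starRingEnd ℂ x) :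
    ∃ h ∈ ringClassGal ι n, ∀ x, τ (emb x) = emb (τn (h x)) := by
  obtain ⟨g, hg⟩ := exists_algEquiv_apply_ringHom_eq hK ι hn emb τ
  rcases RingClassConj.mem_ringClassGal_or_conj_mul_mem hτn hK g with hmem | hmem
  · -- `g ∈ 𝒢_n` would make `τ` trivial on `K`: excluded by `c ≠ 1`
    exfalso
    apply hc
    ext k
    have h1 : τ (emb (algebraMap K (ringClassField K ι n) k)) =
        emb (algebraMap K (ringClassField K ι n) k) := by
      rw [hg, smul_algebraMap_of_mem_ringClassGal hmem]
    rw [hemb, hτ] at h1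
    exact (algebraMap K (AlgebraicClosure K)).injective h1
  · refine ⟨τn * g, hmem, fun x ↦ ?_⟩
    rw [hg, AlgEquiv.mul_apply, ← AlgEquiv.mul_apply τn τn, RingClassConj.conj_mul_self hτn,
      AlgEquiv.one_apply]

/-- **`j (P₀ ↑ K[n]) = toGeomPoints (W⁄K) P₀`**: pushing a `K`-rational point to `E(K[n])` and then
along an embedding `emb : K[n] → K̄` that is the identity on `K` is the inclusion `E(K) ⊆ E(K̄)`;
both maps act coordinatewise. Twin of x11b3's `KolyvaginBottom.toGeomPoints_map_algebraMap`.
[folklore] -/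
theorem map_map_algebraMap_eq_toGeomPoints (emb : ringClassField K ι n →+* AlgebraicClosure K)
    (hemb : ∀ k : K, emb (algebraMap K (ringClassField K ι n) k) = algebraMap K (AlgebraicClosure K) k)
    (j : (W.baseChange (ringClassField K ι n)).toAffine.Point →+ geomPoints (W.baseChange K))
    (hj : j = WeierstrassCurve.Affine.Point.map (W' := W) emb.toRatAlgHom)
    (P₀ : (W.baseChange K).toAffine.Point) :
    j (WeierstrassCurve.Affine.Point.map (W' := W)
        (algebraMap K (ringClassField K ι n)).toRatAlgHom P₀) =
      toGeomPoints (W.baseChange K) P₀ := by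
  subst hj
  have hcomp : emb.toRatAlgHom.comp (algebraMap K (ringClassField K ι n)).toRatAlgHom =
      (algebraMap K (AlgebraicClosure K)).toRatAlgHom :=
    AlgHom.ext fun k ↦ hemb k
  change WeierstrassCurve.Affine.Point.map (W' := W) emb.toRatAlgHom
      (WeierstrassCurve.Affine.Point.map (W' := W)
        (algebraMap K (ringClassField K ι n)).toRatAlgHom P₀) = _
  rw [WeierstrassCurve.Affine.Point.map_map, hcomp]
  cases P₀ <;> rfl

/-! ### §2 The bottom level: `P(1) = Tr_{K[1]/K} y(1) = y_K` -/

/-- **At conductor `1` the transversal is all of `𝒢_1`.** If `S ⊆ 𝒢_1` is a transversal of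
`G_1 = Gal(K[1]/K[1])` in `𝒢_1` (every `g ∈ 𝒢_1` has a unique `s ∈ S` with `g⁻¹ s ∈ G_1`), then
`g ∈ S ↔ g ∈ 𝒢_1`, because `G_1 = 1` (`RingClassTower.ringClassGalOver_self_le`). (Gross 1991, §4:
at `n = 1`, `P_1 = Σ_{σ ∈ 𝒢_1} σ y_1`.) [cite: GrossLMS1991, §4 (4.1)] -/
theorem mem_transversal_one_iff (ι : K →+* ℂ)
    {S : Finset (ringClassField K ι 1 ≃ₐ[ℚ] ringClassField K ι 1)}
    (hSsub : ∀ s ∈ S, s ∈ ringClassGal ι 1)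
    (hStr : ∀ g ∈ ringClassGal ι 1, ∃! s, s ∈ S ∧ g⁻¹ * s ∈ ringClassGalOver ι 1 1)
    (g : ringClassField K ι 1 ≃ₐ[ℚ] ringClassField K ι 1) :
    g ∈ S ↔ g ∈ ringClassGal ι 1 := by
  refine ⟨hSsub g, fun hg ↦ ?_⟩
  obtain ⟨s, ⟨hs, hgs⟩, -⟩ := hStr g hg
  have h1 : g⁻¹ * s ∈ (⊥ : Subgroup (ringClassField K ι 1 ≃ₐ[ℚ] ringClassField K ι 1)) :=
    RingClassTower.ringClassGalOver_self_le ι 1 ⊥ hgs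
  rw [Subgroup.mem_bot, inv_mul_eq_one] at h1
  rwa [h1]

/-- **THE BOTTOM CLAUSE `Pt 1 = toGeomPoints (W⁄K) y_K`** of the `hpointsRk` binder of p482014, for
bare data. Abstract datum at level `1` (the bridge dictionary of p488224 `h37_of_labels`): a
commutative group `𝒢` acting on `A₀` with an injective `ρ : 𝒢 → Aut_ℚ(K[1])`, an identification
`iA : A₀ ≃ E(K[1])` intertwining the actions, a subgroup `H` mapped by `ρ` into `G_1 = Gal(K[1]/K[1])`,
a section `f` of `𝒢 → 𝒢/H` landing in a transversal `S ⊆ 𝒢_1` of `G_1` contained in `ρ(𝒢)`; an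
embedding `emb : K[1] → K̄` which is the identity on `K` and `j = E(emb)`. LABEL (B2) (hypothesis
`hB2`, Gross (4.1) ∕ Bertolini–Darmon §2.5: `y_K ↑ K[1] = Σ_{g ∈ T} g y(1)` for every finset `T`
enumerating `𝒢_1`). Conclusion: `j (iA (P(1))) = toGeomPoints (W⁄K) y_K`, where
`P(1) = kolyvaginPoint σ ∅ f y` is the abstract Kolyvagin point at level `1` (`D_∅ = 1`, so
`P(1) = Σ_{c ∈ 𝒢/H} f(c) y`). Proof: `iA (P(1)) = derivedPoint 1 S (iA y) = Σ_{s ∈ S} s (iA y)`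
(`KolyvaginH37Bridge.map_kolyvaginPoint_eq_derivedPoint` at `k = 1`, `derivedPoint_one`), `S = 𝒢_1`
as a finset (`mem_transversal_one_iff`), (B2), and `map_map_algebraMap_eq_toGeomPoints`.
[cite: GrossLMS1991, §4 (4.1) "P_1 = Tr_{K_1/K} y_1 = y_K"] [cite: BertoliniDarmon1996, §2.5] -/
theorem map_kolyvaginPoint_one_eq_toGeomPoints (ι : K →+* ℂ)
    {𝒢 : Type*} [CommGroup 𝒢] {A₀ : Type*} [AddCommGroup A₀] [DistribMulAction 𝒢 A₀]
    {H : Subgroup 𝒢} [Fintype (𝒢 ⧸ H)]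
    (ρ : 𝒢 →* (ringClassField K ι 1 ≃ₐ[ℚ] ringClassField K ι 1)) (hρ : Function.Injective ρ)
    (iA : A₀ ≃+ (W.baseChange (ringClassField K ι 1)).toAffine.Point)
    (hiA : ∀ (g : 𝒢) (a : A₀), iA (g • a) = pointGalHom W (ringClassField K ι 1) (ρ g) (iA a))
    (hHρ : ∀ h ∈ H, ρ h ∈ ringClassGalOver ι 1 1)
    {S : Finset (ringClassField K ι 1 ≃ₐ[ℚ] ringClassField K ι 1)}
    (hSsub : ∀ s ∈ S, s ∈ ringClassGal ι 1)
    (hSρ : (S : Set (ringClassField K ι 1 ≃ₐ[ℚ] ringClassField K ι 1)) ⊆ Set.range ρ)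
    (hStr : ∀ g ∈ ringClassGal ι 1, ∃! s, s ∈ S ∧ g⁻¹ * s ∈ ringClassGalOver ι 1 1)
    (f : 𝒢 ⧸ H → 𝒢) (hfsec : ∀ c, (f c : 𝒢 ⧸ H) = c) (hfS : ∀ c, ρ (f c) ∈ S)
    (σ : ℕ → 𝒢) (y : A₀) {yK : (W.baseChange K).toAffine.Point}
    (hB2 : ∀ T : Finset (ringClassField K ι 1 ≃ₐ[ℚ] ringClassField K ι 1),
      (∀ g, g ∈ T ↔ g ∈ ringClassGal ι 1) →
      WeierstrassCurve.Affine.Point.map (W' := W)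
          (algebraMap K (ringClassField K ι 1)).toRatAlgHom yK =
        ∑ g ∈ T, pointGalHom W (ringClassField K ι 1) g (iA y))
    (emb : ringClassField K ι 1 →+* AlgebraicClosure K)
    (hemb : ∀ k : K, emb (algebraMap K (ringClassField K ι 1) k) = algebraMap K (AlgebraicClosure K) k)
    (j : (W.baseChange (ringClassField K ι 1)).toAffine.Point →+ geomPoints (W.baseChange K))
    (hj : j = WeierstrassCurve.Affine.Point.map (W' := W) emb.toRatAlgHom) :
    j (iA (kolyvaginPoint σ (1 : ℕ).primeFactors f y)) = toGeomPoints (W.baseChange K) yK := by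
  have hbij := KolyvaginH37Bridge.bijOn_of_section_of_transversal ρ hρ (H := H)
    (Γ := ringClassGal ι 1) (G₁ := ringClassGalOver ι 1 1) hHρ
    (S := (↑S : Set (ringClassField K ι 1 ≃ₐ[ℚ] ringClassField K ι 1)))
    (fun s hs ↦ hSsub s hs) hSρ (fun g hg ↦ hStr g hg) f hfsec hfS
  have h1 : iA (kolyvaginPoint σ (1 : ℕ).primeFactors f y) =
      KolyvaginOperator.derivedPoint (pointGalHom W (ringClassField K ι 1)) (fun q ↦ ρ (σ q)) 1 S
        (iA y) :=
    KolyvaginH37Bridge.map_kolyvaginPoint_eq_derivedPoint (pointGalHom W (ringClassField K ι 1)) ρ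
      (iA : A₀ →+ (W.baseChange (ringClassField K ι 1)).toAffine.Point) hiA squarefree_one
      (τ := fun q ↦ ρ (σ q)) (fun _ _ ↦ rfl) f hbij y
  rw [KolyvaginOperator.derivedPoint_one] at h1
  have hS : ∀ g, g ∈ S ↔ g ∈ ringClassGal ι 1 := mem_transversal_one_iff ι hSsub hStr
  rw [h1, ← hB2 S hS]
  exact map_map_algebraMap_eq_toGeomPoints emb hemb j hj yK

end Summit.BirchSwinnertonDyer.BirchSwinnertonDyer.Theorems

end
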